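import Summits.QuantumFields.YangMills.Theorems.FluctuationComparisonRegPrIntLOrganTangentMarginalHClause
import Summits.QuantumFields.YangMills.Theorems.FluctuationComparisonRegPrIntLOrganTangentHClauseBlock
import HarnessLib

/-!
# THE MARGINAL-SLOT ERASER — marginal-slot H-presentations ⟺ marginal-free ones, BY NAME (tool brick (KIT-3)∕(O1) of the LEAD-20520 w3 g25 lane)

Cell `ym3-torus` (YM ladder rung R3 = continuum `SU(2)` Yang–Mills on the three-torus — a RUNG: NOT d = 4, NOT infinite volume, NOT a mass
gap, NOT Clay).  Seat `ym-line-cst-p1` g41 (FREE hand); crux `stmt-QuantumFields-20520` (`…Theses.UnitScaleTilt.FluctuationComparisonRegPrIntL`),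
organ-tangent lane; `--kind proof --supports stmt-QuantumFields-20520 --as helper`: count-neutral, DEFINITION-FREE (0 `def`, 0 `instance`, 0 `notation`,
default heartbeats), no registry ∕ binder ∕ `Lines/` byte.

WHAT.  O1ᵘ-H v2 ∕ LINᵘ-H ∕ JENᵘ-H (px19 `hO` de4191aa, LEAD `g25/LINuH`∕`JENuH` texts) present a piece `f` at height `j` through a MARGINAL SLOT: letters
`(c', a', w', k')` with `∀ p, |c' p| ≤ a'`, `rowMass_κ k' ≤ w'` and the scaled pair clause `HClauseSq θ r k' (f − β·Σ_p c' p·(1 − reTr U(∂p)))`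
(`β = L^j∕γ`, `θ = θBal_j∕4`).  LEAD w3 g25 №3 ∕ ideator g27 №10 (2)(ii): «marginal-slot and marginal-free editions of any H-presentation differ by
`θ·x′ ≤ 48·e^{2κ}·θ·a`; no re-type ever needed».  THIS FILE is that sentence AS NAMES, composing ✓px8 g20 (MH) `hClauseSq_marginal` ∕ `kW_nonneg` ∕
`rowMass_marginal_le_of_d_eq_three` (the marginal `β·Σ c'·(1 − reTr)` is ITSELF clause-`k_W` with row mass `≤ 3·β·θ²·a'·16·e^{2κ}`) with ✓cst-p1 (KIT)
`hClauseSq_add` ∕ `hClauseSq_congr` ∕ `rowMass_add_le`: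

* §1 ★★ `block_marginalFree_of_slot` (`d = 3`, `0 ≤ β`, `0 < θ`, `0 ≤ κ`): the `∃ k`-BLOCK for the slot piece `f − β·Σ c'·(1 − reTr)` with row mass `w'`
  gives the `∃ k`-BLOCK for `f` ITSELF with row mass `w' + 3·β·θ²·a'·16·e^{2κ}` (letters `k' + k_W`); ★ `block_slot_of_marginalFree`: conversely a block
  for `f` is a block for the slot piece with `c' := 0` (same letters, same mass); `block_slot_of_marginalFree'`: … and for ANY `c'` with `|c'| ≤ a'` at the
  price `+ 3·β·θ²·a'·16·e^{2κ}` (subtract the marginal).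
* §2 THE BUDGET LINE: `budget_marginalFree` — from `a' + θ₀·(w'∕D) ≤ Bud` (the `hO` budget shape, `D = β·θBal_j² = 16·β·θ²` the window unit) to
  `0 + θ₀·((w' + 3·β·θ²·a'·16·e^{2κ})∕D) ≤ max 1 (3·θ₀·e^{2κ})·Bud`; so under `3·θ₀·e^{2κ} ≤ 1` the marginal-free edition keeps the budget VERBATIM
  (`budget_marginalFree_of_small`).
* §3 ★★ `presentation_marginalFree_of_slot`: the two layers together, in `hO`'s output-package shape
  `∃ c' a' w', 0 ≤ a' ∧ 0 ≤ w' ∧ a' + θ₀·(w'∕D) ≤ Bud ∧ (∀ p, |c' p| ≤ a') ∧ ∃ k', ⟨block⟩` ⟹ the same package for `f` with `c' := 0`, `a' := 0` and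
  budget `max 1 (3·θ₀·e^{2κ})·Bud` (with `D := 16·β·θ²` displayed; `0 < β`).

HONEST.  [folklore] bookkeeping over HYPOTHESIS-shaped texts; nothing of Bałaban's is asserted or proved; LINᵘ-H, JENᵘ-H, JVARᵘ-H, O1ᵘ-H v2 (XL), S1aᴴ,
S2β's five registered stubs, crux 20520 and the leaf `YM3TorusSU2` are NOT proved; rung R3 = SU(2) YM₃ on T³ at fixed lattice data — NOT d = 4, NOT
infinite volume, NOT a mass gap, NOT Clay; the Yang–Mills mass gap is NOT proved.  Sorry-free, axioms standard.
-/

set_option autoImplicit false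

noncomputable section

open scoped BigOperators
open Literature.MathematicalPhysics.QuantumFieldTheory.Balaban1983to89
open T4CubeChartGnomonic (SU2)
open T4CubeChartExp (expPt)
open T4WilsonLinkAffine (IsLetter)
open Summit.QuantumFields.YangMills.Theorems.OrganTangentMarginalHClause (hClauseSq_marginal kW_nonneg rowMass_marginal_le_of_d_eq_three)
open Summit.QuantumFields.YangMills.Theorems.OrganTangentHClauseAlgebra (hClauseSq_add hClauseSq_sub hClauseSq_congr rowMass_add_le)

namespace Summit.QuantumFields.YangMills.Theorems.OrganTangentMarginalSlotEraser

variable {P : Params} {j : ℕ} [DecidableEq (PBond P j)]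

/-! ## §1 The `∃ k`-block: slot ⟺ slot-free -/

section Block

variable {β θ r κ a' w' : ℝ} {f : GaugeField P j SU2 → ℝ} {c' : Plaq P j → ℝ}

/-- ★★ **SLOT ⟹ SLOT-FREE ON THE `∃ k`-BLOCK** (`d = 3`): if the slot piece `f − β·Σ_p c' p·(1 − reTr U(∂p))` carries the block with row mass `w'`
and `|c'| ≤ a'`, then `f` carries the block with row mass `w' + 3·β·θ²·a'·16·e^{2κ}` — letters `k' + k_W`, ✓(MH) `hClauseSq_marginal` + ✓(KIT)
`hClauseSq_add`. [folklore] -/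
theorem block_marginalFree_of_slot (hd : P.d = 3) (hβ : 0 ≤ β) (hθ : 0 < θ) (hκ : 0 ≤ κ) (ha' : ∀ p, |c' p| ≤ a')
    (h : ∃ k : PBond P j → PBond P j → ℝ, (∀ b b', 0 ≤ k b b') ∧ (∀ b, ∑ b', k b b' * Real.exp (κ * (b.src.tdist b'.src : ℝ)) ≤ w') ∧
      ∀ (b b' : PBond P j) (v v' : Fin 3 → ℝ) (U V W Z : GaugeField P j SU2),
        ‖v‖ ≤ r * θ → ‖v'‖ ≤ r * θ → PlaqSmall θ U → PlaqSmall θ V → PlaqSmall θ W → PlaqSmall θ Z →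
        (∀ e, e ≠ b → V e = U e) → V b = U b * expPt v → (∀ e, e ≠ b' → W e = U e) → W b' = U b' * expPt v' →
        (∀ e, e ≠ b' → Z e = V e) → Z b' = V b' * expPt v' →
        |(f Z - β * ∑ p, c' p * (1 - reTr (GaugeField.plaqHol Z p))) - (f V - β * ∑ p, c' p * (1 - reTr (GaugeField.plaqHol V p))) -
            (f W - β * ∑ p, c' p * (1 - reTr (GaugeField.plaqHol W p))) + (f U - β * ∑ p, c' p * (1 - reTr (GaugeField.plaqHol U p)))| ≤
          k b b' * (‖v‖ / θ) * (‖v'‖ / θ)) :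
    ∃ k : PBond P j → PBond P j → ℝ, (∀ b b', 0 ≤ k b b') ∧
      (∀ b, ∑ b', k b b' * Real.exp (κ * (b.src.tdist b'.src : ℝ)) ≤ w' + 3 * β * θ ^ 2 * a' * 16 * Real.exp (2 * κ)) ∧
      ∀ (b b' : PBond P j) (v v' : Fin 3 → ℝ) (U V W Z : GaugeField P j SU2),
        ‖v‖ ≤ r * θ → ‖v'‖ ≤ r * θ → PlaqSmall θ U → PlaqSmall θ V → PlaqSmall θ W → PlaqSmall θ Z →
        (∀ e, e ≠ b → V e = U e) → V b = U b * expPt v → (∀ e, e ≠ b' → W e = U e) → W b' = U b' * expPt v' →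
        (∀ e, e ≠ b' → Z e = V e) → Z b' = V b' * expPt v' →
        |f Z - f V - f W + f U| ≤ k b b' * (‖v‖ / θ) * (‖v'‖ / θ) := by
  obtain ⟨k', hk', hr', hc'⟩ := h
  have hM := hClauseSq_marginal c' hβ hθ r
  refine ⟨fun b b' => k' b b' + 3 * β * θ ^ 2 * ∑ p, |c' p| * (if IsLetter b p ∧ IsLetter b' p then (1:ℝ) else 0),
    fun b b' => add_nonneg (hk' b b') (kW_nonneg c' hβ θ b b'),
    rowMass_add_le hr' (fun b => rowMass_marginal_le_of_d_eq_three hd c' θ ha' hβ hκ b), ?_⟩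
  exact hClauseSq_congr (R' := f) (hClauseSq_add hc' hM) (fun U _ => by ring) (fun _ _ => le_rfl)

omit [DecidableEq (PBond P j)] in
/-- ★ **SLOT-FREE ⟹ SLOT WITH `c' := 0`**: a block for `f` is a block for `f − β·Σ_p 0·(1 − reTr U(∂p))` (same letters, same row mass). [folklore] -/
theorem block_slot_of_marginalFree
    (h : ∃ k : PBond P j → PBond P j → ℝ, (∀ b b', 0 ≤ k b b') ∧ (∀ b, ∑ b', k b b' * Real.exp (κ * (b.src.tdist b'.src : ℝ)) ≤ w') ∧
      ∀ (b b' : PBond P j) (v v' : Fin 3 → ℝ) (U V W Z : GaugeField P j SU2),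
        ‖v‖ ≤ r * θ → ‖v'‖ ≤ r * θ → PlaqSmall θ U → PlaqSmall θ V → PlaqSmall θ W → PlaqSmall θ Z →
        (∀ e, e ≠ b → V e = U e) → V b = U b * expPt v → (∀ e, e ≠ b' → W e = U e) → W b' = U b' * expPt v' →
        (∀ e, e ≠ b' → Z e = V e) → Z b' = V b' * expPt v' →
        |f Z - f V - f W + f U| ≤ k b b' * (‖v‖ / θ) * (‖v'‖ / θ)) :
    ∃ k : PBond P j → PBond P j → ℝ, (∀ b b', 0 ≤ k b b') ∧ (∀ b, ∑ b', k b b' * Real.exp (κ * (b.src.tdist b'.src : ℝ)) ≤ w') ∧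
      ∀ (b b' : PBond P j) (v v' : Fin 3 → ℝ) (U V W Z : GaugeField P j SU2),
        ‖v‖ ≤ r * θ → ‖v'‖ ≤ r * θ → PlaqSmall θ U → PlaqSmall θ V → PlaqSmall θ W → PlaqSmall θ Z →
        (∀ e, e ≠ b → V e = U e) → V b = U b * expPt v → (∀ e, e ≠ b' → W e = U e) → W b' = U b' * expPt v' →
        (∀ e, e ≠ b' → Z e = V e) → Z b' = V b' * expPt v' →
        |(f Z - β * ∑ p, (fun (_ : Plaq P j) => (0:ℝ)) p * (1 - reTr (GaugeField.plaqHol Z p))) -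
            (f V - β * ∑ p, (fun (_ : Plaq P j) => (0:ℝ)) p * (1 - reTr (GaugeField.plaqHol V p))) -
            (f W - β * ∑ p, (fun (_ : Plaq P j) => (0:ℝ)) p * (1 - reTr (GaugeField.plaqHol W p))) +
            (f U - β * ∑ p, (fun (_ : Plaq P j) => (0:ℝ)) p * (1 - reTr (GaugeField.plaqHol U p)))| ≤
          k b b' * (‖v‖ / θ) * (‖v'‖ / θ) := by
  obtain ⟨k, hk, hr, hc⟩ := h
  refine ⟨k, hk, hr, ?_⟩
  exact hClauseSq_congr (R := f) hc (fun U _ => by simp) (fun _ _ => le_rfl)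

/-- ★ **SLOT-FREE ⟹ SLOT WITH ANY `c'`, `|c'| ≤ a'`** (`d = 3`): a block for `f` with row mass `w'` is a block for `f − β·Σ c'·(1 − reTr)` with row mass
`w' + 3·β·θ²·a'·16·e^{2κ}` (subtract the marginal's own block). [folklore] -/
theorem block_slot_of_marginalFree' (hd : P.d = 3) (hβ : 0 ≤ β) (hθ : 0 < θ) (hκ : 0 ≤ κ) (ha' : ∀ p, |c' p| ≤ a')
    (h : ∃ k : PBond P j → PBond P j → ℝ, (∀ b b', 0 ≤ k b b') ∧ (∀ b, ∑ b', k b b' * Real.exp (κ * (b.src.tdist b'.src : ℝ)) ≤ w') ∧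
      ∀ (b b' : PBond P j) (v v' : Fin 3 → ℝ) (U V W Z : GaugeField P j SU2),
        ‖v‖ ≤ r * θ → ‖v'‖ ≤ r * θ → PlaqSmall θ U → PlaqSmall θ V → PlaqSmall θ W → PlaqSmall θ Z →
        (∀ e, e ≠ b → V e = U e) → V b = U b * expPt v → (∀ e, e ≠ b' → W e = U e) → W b' = U b' * expPt v' →
        (∀ e, e ≠ b' → Z e = V e) → Z b' = V b' * expPt v' →
        |f Z - f V - f W + f U| ≤ k b b' * (‖v‖ / θ) * (‖v'‖ / θ)) :
    ∃ k : PBond P j → PBond P j → ℝ, (∀ b b', 0 ≤ k b b') ∧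
      (∀ b, ∑ b', k b b' * Real.exp (κ * (b.src.tdist b'.src : ℝ)) ≤ w' + 3 * β * θ ^ 2 * a' * 16 * Real.exp (2 * κ)) ∧
      ∀ (b b' : PBond P j) (v v' : Fin 3 → ℝ) (U V W Z : GaugeField P j SU2),
        ‖v‖ ≤ r * θ → ‖v'‖ ≤ r * θ → PlaqSmall θ U → PlaqSmall θ V → PlaqSmall θ W → PlaqSmall θ Z →
        (∀ e, e ≠ b → V e = U e) → V b = U b * expPt v → (∀ e, e ≠ b' → W e = U e) → W b' = U b' * expPt v' →
        (∀ e, e ≠ b' → Z e = V e) → Z b' = V b' * expPt v' →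
        |(f Z - β * ∑ p, c' p * (1 - reTr (GaugeField.plaqHol Z p))) - (f V - β * ∑ p, c' p * (1 - reTr (GaugeField.plaqHol V p))) -
            (f W - β * ∑ p, c' p * (1 - reTr (GaugeField.plaqHol W p))) + (f U - β * ∑ p, c' p * (1 - reTr (GaugeField.plaqHol U p)))| ≤
          k b b' * (‖v‖ / θ) * (‖v'‖ / θ) := by
  obtain ⟨k', hk', hr', hc'⟩ := h
  have hM := hClauseSq_marginal c' hβ hθ r
  exact ⟨fun b b' => k' b b' + 3 * β * θ ^ 2 * ∑ p, |c' p| * (if IsLetter b p ∧ IsLetter b' p then (1:ℝ) else 0),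
    fun b b' => add_nonneg (hk' b b') (kW_nonneg c' hβ θ b b'),
    rowMass_add_le hr' (fun b => rowMass_marginal_le_of_d_eq_three hd c' θ ha' hβ hκ b), hClauseSq_sub hc' hM⟩

end Block

/-! ## §2 The budget line -/

section Budget

/-- **THE BUDGET LINE AFTER ERASING THE SLOT**: from `a' + θ₀·(w'∕D) ≤ Bud` (`0 ≤ a'`, `0 ≤ θ₀`, `0 < D`, and `D = 16·β·θ²` the window unit
`β·θBal²` at `θ = θBal∕4`) to `θ₀·((w' + 3·β·θ²·a'·16·e^{2κ})∕D) ≤ max 1 (3·θ₀·e^{2κ})·Bud`. [folklore] -/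
theorem budget_marginalFree {a' w' θ₀ D β θ κ Bud : ℝ} (ha : 0 ≤ a') (hθ₀ : 0 ≤ θ₀) (hD : 0 < D) (hDval : D = 16 * β * θ ^ 2)
    (hw : 0 ≤ w') (hbud : a' + θ₀ * (w' / D) ≤ Bud) :
    θ₀ * ((w' + 3 * β * θ ^ 2 * a' * 16 * Real.exp (2 * κ)) / D) ≤ max 1 (3 * θ₀ * Real.exp (2 * κ)) * Bud := by
  have hM : 0 ≤ 3 * θ₀ * Real.exp (2 * κ) := by positivity
  have hx : 0 ≤ θ₀ * (w' / D) := mul_nonneg hθ₀ (div_nonneg hw hD.le)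
  have hBud : 0 ≤ Bud := le_trans (add_nonneg ha hx) hbud
  -- the erased slot costs `3·θ₀·e^{2κ}·a'`
  have hβ0 : β ≠ 0 := by rintro rfl; simp at hDval; exact hD.ne' hDval
  have hθ0 : θ ≠ 0 := by rintro rfl; simp at hDval; exact hD.ne' hDval
  have hsplit : θ₀ * ((w' + 3 * β * θ ^ 2 * a' * 16 * Real.exp (2 * κ)) / D) = θ₀ * (w' / D) + (3 * θ₀ * Real.exp (2 * κ)) * a' := by
    rw [hDval]
    field_simp
  rw [hsplit]
  have h1 : θ₀ * (w' / D) ≤ max 1 (3 * θ₀ * Real.exp (2 * κ)) * (θ₀ * (w' / D)) :=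
    le_mul_of_one_le_left hx (le_max_left _ _)
  have h2 : (3 * θ₀ * Real.exp (2 * κ)) * a' ≤ max 1 (3 * θ₀ * Real.exp (2 * κ)) * a' :=
    mul_le_mul_of_nonneg_right (le_max_right _ _) ha
  calc θ₀ * (w' / D) + 3 * θ₀ * Real.exp (2 * κ) * a'
      ≤ max 1 (3 * θ₀ * Real.exp (2 * κ)) * (θ₀ * (w' / D)) + max 1 (3 * θ₀ * Real.exp (2 * κ)) * a' := add_le_add h1 h2
    _ = max 1 (3 * θ₀ * Real.exp (2 * κ)) * (a' + θ₀ * (w' / D)) := by ring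
    _ ≤ max 1 (3 * θ₀ * Real.exp (2 * κ)) * Bud := mul_le_mul_of_nonneg_left hbud (le_trans zero_le_one (le_max_left _ _))

/-- **… AND WITH A SMALL `θ₀`** (`3·θ₀·e^{2κ} ≤ 1`): the budget is kept VERBATIM. [folklore] -/
theorem budget_marginalFree_of_small {a' w' θ₀ D β θ κ Bud : ℝ} (ha : 0 ≤ a') (hθ₀ : 0 ≤ θ₀) (hD : 0 < D) (hDval : D = 16 * β * θ ^ 2)
    (hw : 0 ≤ w') (hsmall : 3 * θ₀ * Real.exp (2 * κ) ≤ 1) (hbud : a' + θ₀ * (w' / D) ≤ Bud) :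
    θ₀ * ((w' + 3 * β * θ ^ 2 * a' * 16 * Real.exp (2 * κ)) / D) ≤ Bud := by
  have h := budget_marginalFree (κ := κ) ha hθ₀ hD hDval hw hbud
  rwa [max_eq_left hsmall, one_mul] at h

end Budget

/-! ## §3 The whole output package of `hO` ∕ LINᵘ-H ∕ JENᵘ-H: slot ⟹ slot-free -/

section Package

variable {β θ r κ θ₀ Bud : ℝ} {f : GaugeField P j SU2 → ℝ}

/-- ★★ **THE PRESENTATION, MARGINAL-FREE**: in `hO`'s output-package shape (window unit `D := 16·β·θ²` DISPLAYED, i.e. `β_j·θBal_j²` at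
`θ = θBal_j∕4`; `d = 3`, `0 < β`, `0 < θ`, `0 ≤ κ`, `0 ≤ θ₀`): a marginal-SLOT presentation `(c', a', w', k')` of `f` with budget `Bud` yields the
marginal-FREE presentation `(0, 0, w' + 3·β·θ²·a'·16·e^{2κ}, k' + k_W)` of `f` with budget `max 1 (3·θ₀·e^{2κ})·Bud`. [folklore] -/
theorem presentation_marginalFree_of_slot (hd : P.d = 3) (hβ : 0 < β) (hθ : 0 < θ) (hκ : 0 ≤ κ) (hθ₀ : 0 ≤ θ₀)
    (h : ∃ (c' : Plaq P j → ℝ) (a' w' : ℝ), 0 ≤ a' ∧ 0 ≤ w' ∧ a' + θ₀ * (w' / (16 * β * θ ^ 2)) ≤ Bud ∧ (∀ p, |c' p| ≤ a') ∧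
      ∃ k : PBond P j → PBond P j → ℝ, (∀ b b', 0 ≤ k b b') ∧ (∀ b, ∑ b', k b b' * Real.exp (κ * (b.src.tdist b'.src : ℝ)) ≤ w') ∧
        ∀ (b b' : PBond P j) (v v' : Fin 3 → ℝ) (U V W Z : GaugeField P j SU2),
          ‖v‖ ≤ r * θ → ‖v'‖ ≤ r * θ → PlaqSmall θ U → PlaqSmall θ V → PlaqSmall θ W → PlaqSmall θ Z →
          (∀ e, e ≠ b → V e = U e) → V b = U b * expPt v → (∀ e, e ≠ b' → W e = U e) → W b' = U b' * expPt v' →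
          (∀ e, e ≠ b' → Z e = V e) → Z b' = V b' * expPt v' →
          |(f Z - β * ∑ p, c' p * (1 - reTr (GaugeField.plaqHol Z p))) - (f V - β * ∑ p, c' p * (1 - reTr (GaugeField.plaqHol V p))) -
              (f W - β * ∑ p, c' p * (1 - reTr (GaugeField.plaqHol W p))) + (f U - β * ∑ p, c' p * (1 - reTr (GaugeField.plaqHol U p)))| ≤
            k b b' * (‖v‖ / θ) * (‖v'‖ / θ)) :
    ∃ (c' : Plaq P j → ℝ) (a' w' : ℝ), 0 ≤ a' ∧ 0 ≤ w' ∧ a' + θ₀ * (w' / (16 * β * θ ^ 2)) ≤ max 1 (3 * θ₀ * Real.exp (2 * κ)) * Bud ∧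
      (∀ p, |c' p| ≤ a') ∧
      ∃ k : PBond P j → PBond P j → ℝ, (∀ b b', 0 ≤ k b b') ∧ (∀ b, ∑ b', k b b' * Real.exp (κ * (b.src.tdist b'.src : ℝ)) ≤ w') ∧
        ∀ (b b' : PBond P j) (v v' : Fin 3 → ℝ) (U V W Z : GaugeField P j SU2),
          ‖v‖ ≤ r * θ → ‖v'‖ ≤ r * θ → PlaqSmall θ U → PlaqSmall θ V → PlaqSmall θ W → PlaqSmall θ Z →
          (∀ e, e ≠ b → V e = U e) → V b = U b * expPt v → (∀ e, e ≠ b' → W e = U e) → W b' = U b' * expPt v' →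
          (∀ e, e ≠ b' → Z e = V e) → Z b' = V b' * expPt v' →
          |(f Z - β * ∑ p, c' p * (1 - reTr (GaugeField.plaqHol Z p))) - (f V - β * ∑ p, c' p * (1 - reTr (GaugeField.plaqHol V p))) -
              (f W - β * ∑ p, c' p * (1 - reTr (GaugeField.plaqHol W p))) + (f U - β * ∑ p, c' p * (1 - reTr (GaugeField.plaqHol U p)))| ≤
            k b b' * (‖v‖ / θ) * (‖v'‖ / θ) := by
  obtain ⟨c', a', w', ha, hw, hbud, hc', hblock⟩ := h
  have hD : 0 < 16 * β * θ ^ 2 := by positivity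
  have hB := block_marginalFree_of_slot (f := f) hd hβ.le hθ hκ hc' hblock
  have hw'' : 0 ≤ w' + 3 * β * θ ^ 2 * a' * 16 * Real.exp (2 * κ) := by positivity
  refine ⟨fun _ => 0, 0, w' + 3 * β * θ ^ 2 * a' * 16 * Real.exp (2 * κ), le_rfl, hw'', ?_, fun p => by simp, ?_⟩
  · rw [zero_add]
    exact budget_marginalFree (κ := κ) ha hθ₀ hD rfl hw hbud
  · exact block_slot_of_marginalFree (β := β) hB

end Package

end Summit.QuantumFields.YangMills.Theorems.OrganTangentMarginalSlotEraser

end
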